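import Summits.BirchSwinnertonDyer.BirchSwinnertonDyer.Theorems.PrintCf2SplitBadTwoRestrictedControlOfLocSurjBVNoCT
import Summits.BirchSwinnertonDyer.BirchSwinnertonDyer.Theorems.PrintCf2SplitBadTwoRestrictedLocSurjFinOfPoitouTate
import Summits.BirchSwinnertonDyer.BirchSwinnertonDyer.Theorems.PrintCf2SplitBadTwoSelmerBranchFrame
import HarnessLib

/-!
# Crux `PrintCf2.SplitBadTwoRankOneOfFacts` (stmt-BirchSwinnertonDyer-20368), road α v10.3 — S3c assembly, THIRTEENTH CUT: (LS) AND (H1-Sel) DISCHARGED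
# `stub_restrictedControl_two` ⟸ [three Poitou–Tate/cd named facts] ∧ (F1) ∧ (F3) ∧ (H2) ∧ (T-loc-cl)

Cell `bsd-print-cf2`, LEAD seat `bsd-line-cf2-p1` g12 (prover-bsd-line-cf2-p1-g12-0); `--supports stmt-BirchSwinnertonDyer-20368` (helper, Theses-free).
HONEST FRAMING: proves the registered statement of S3c from DISPLAYED HYPOTHESES, three of which are the tree's NAMED (unproved, published) facts
`poitouTate_sha_tateDual` [Harari 2020 Thm. 17.13], `poitouTate_selmerStructure_duality` [Milne ADT I.4.10; Poitou–Tate for Selmer structures] and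
`fieldCdLE_two_of_numberField` [Serre, Galois Cohomology II §4.4 Prop. 13]; BSD is not proved by any of this; no summit statement is proved by this seat.
No definition, no `sorry`.

WHAT CHANGED AGAINST CUT 12 (`restrictedControl_two_of_locSurj_factor_values`, p674084). Two more displayed hypotheses are theorems of the tree:
* (LS)-under-finiteness `hLSfin` := -w2 g10 `ConjTransport.locSurjFin_of_poitouTate hPTs` (p674366; on -w4 g9's level-lifting port `locSurj_of_proj`,
  conjugate finiteness, relaxed conjugate finiteness, local torsion bound) — CONDITIONAL on the named fact `hPTs`;
* (H1-Sel) `hSel` := -w3 g9 `hSel_of_locCyclic hcl` inside `CMPrimes.rBV_of_factor_values_of_locCyclic hF1 hF3 hH2 hcl` (file `…SelmerBranchFrame`: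
  branch dichotomy + (INF′) discharged + conjugate finiteness), leaving the purely LOCAL cyclicity input **(T-loc-cl)** `hcl`: on every frame the 2-torsion of
  `loc_v` of the classical-at-`v` classes `((W⁄K).localKerOver 2 ⊤ K_v).map res_{⊤ ⊓ D_v}` is cyclic (-w7 g3's local lane: `E(K_v) ⊗ ℚ₂/ℤ₂ ≅ ℚ₂/ℤ₂`).
So S3c ⟸ hPT ∧ hPTs ∧ hcd ∧ **(F1)** [-w6 g3] ∧ **(F3)** [PT lane; LEAD memo F3-PT-ANALYSIS-g12.md] ∧ **(H2)** [-w7 g3] ∧ **(T-loc-cl)** [-w7 g3].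
DISCHARGE AGAINST THIS CUT. presearch: not applicable (assembly of tree theorems). beyond-print theorem: no.

References: [Agboola2007] §3 Prop. 3.2, §5, §6 Prop. 6.10–6.11, Prop. 8.1; [GreenbergLNM1716] §3 Lemmas 3.1–3.3, §4 Lemma 4.2; [Harari2020] Thm. 17.13;
[MilneADT2006] I Thm. 4.10; [SerreGaloisCohomology1997] II §4.4 Prop. 13.
-/

noncomputable section

open scoped Classical

set_option linter.dupNamespace false
set_option autoImplicit false

open NumberField IsDedekindDomain Field WeierstrassCurve
open Literature.NumberTheory.EllipticCurves Literature.NumberTheory.EllipticCurves.GreenbergSelmer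
open Literature.NumberTheory.EllipticCurves.Agboola2007
open Literature.NumberTheory.EllipticCurves.IwasawaAlgebra
open Literature.NumberTheory.EllipticCurves.IwasawaDual
open Literature.NumberTheory.EllipticCurves.ResKernel
open Literature.NumberTheory.GaloisRepresentations
open Literature.NumberTheory.GaloisCohomology
open Literature.NumberTheory.EllipticCurves.Castella2018.AcSelmer
open Summit.BirchSwinnertonDyer.BirchSwinnertonDyer.Theorems.PrintCf2.AdditiveAtSeven
open Summit.BirchSwinnertonDyer.BirchSwinnertonDyer.Theorems.GoldfeldGoodTwists

namespace Summit.BirchSwinnertonDyer.BirchSwinnertonDyer.Theorems.PrintCf2.RestrictedSelmerPair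

/-- **S3c `stub_restrictedControl_two` — THIRTEENTH CUT: ⟸ `poitouTate_sha_tateDual` ∧ `poitouTate_selmerStructure_duality` ∧ `fieldCdLE_two_of_numberField`
∧ (F1) ∧ (F3) ∧ (H2) ∧ (T-loc-cl)**: cut 11 with `hLSfin := ConjTransport.locSurjFin_of_poitouTate hPTs` and `hBV := CMPrimes.rBV_of_factor_values_of_locCyclic
hF1 hF3 hH2 hcl`. CONDITIONAL on the displayed hypotheses (three named Literature facts).
[cite: Agboola2007, §3 Prop. 3.2, §6 Prop. 6.10–6.11, §8 Prop. 8.1] [cite: GreenbergLNM1716, §3 Lemmas 3.1–3.3, §4 Lemma 4.2] [cite: MilneADT2006, I Thm. 4.10] -/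
theorem restrictedControl_two_of_ptFacts_factor_values
    (hPT : ∀ (K : Type) [Field K] [NumberField K], poitouTate_sha_tateDual K)
    (hPTs : ∀ (K : Type) [Field K] [NumberField K], poitouTate_selmerStructure_duality K)
    (hcd : fieldCdLE_two_of_numberField)
    (hF1 : ∃ e₁ : ℤ → ℤ → ℤ, ∀ (d : ℤ), d ≠ 0 → Squarefree d → d % 4 ≠ 1 →
      ∀ (W : WeierstrassCurve ℚ) [W.IsElliptic] [W.IsGloballyMinimal] (C : WeierstrassCurve.VariableChange ℚ),
        C • W = cm7.quadraticTwist (d : ℚ) → W.analyticRank = 1 →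
      ∀ (K : Type) [Field K] [NumberField K], IsImaginaryQuadratic K →
      ∀ (v vbar : HeightOneSpectrum (𝓞 K)),
        ((2 : ℕ) : 𝓞 K) ∈ v.asIdeal → ((2 : ℕ) : 𝓞 K) ∈ vbar.asIdeal → vbar ≠ v →
      ∀ (π : (W.baseChange K).endRing), (π : AddMonoid.End (W.baseChange K).geomPoints) * π = π - 2 →
      ∀ (r : ℤ_[2]), r * r = r - 2 →
        (∀ τ ∈ GreenbergSelmer.inertia v, ∀ x : ↥((W.baseChange K).endEigenPrimaryTorsion 2 π r), τ • x = x ∨ τ • x = -x) →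
      ∀ (P : W.toAffine.Point) (c₀ : ℕ) (ℓ : ℤ),
        ¬ IsOfFinAddOrder P →
        (∀ R : W.toAffine.Point, ∃ (k : ℤ) (T : W.toAffine.Point), IsOfFinAddOrder T ∧ R = k • P + T) →
        c₀ ≠ 0 → (W.baseChange ℚ_[2]).IsInReductionKernel (c₀ • W.toPadicPoint 2 P) →
        ‖(W.baseChange ℚ_[2]).padicLogPoint (c₀ • W.toPadicPoint 2 P) / (c₀ : ℚ_[2])‖ = (2 : ℝ) ^ (-ℓ) →
      Finite (restrictedSelmerBase ↥((W.baseChange K).endEigenPrimaryTorsion 2 π r) 2 vbar) →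
        (padicValNat 2 (Nat.card ↥(((((W.baseChange K).kummerMapPInfty 2 (W.baseChange K).zsmul_geomPoints_surjective_holds).range).map
            (resSubgroup ⊤ ((W.baseChange K).geomPrimaryTorsion 2))).comap
          (resH1Hom (ContinuousMonoidHom.id _) ((W.baseChange K).endEigenPrimaryTorsion 2 π r).subtype (fun _ _ ↦ rfl)) ⊓
          (resOfLe ↥((W.baseChange K).endEigenPrimaryTorsion 2 π r) (inf_le_left : ⊤ ⊓ decomp vbar ≤ ⊤)).ker)) : ℤ) = ℓ + e₁ (d % 2) ((d / (2 - d % 2)) % 8))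
    (hF3 : ∃ e₃ : ℤ → ℤ → ℤ, ∀ (d : ℤ), d ≠ 0 → Squarefree d → d % 4 ≠ 1 →
      ∀ (W : WeierstrassCurve ℚ) [W.IsElliptic] [W.IsGloballyMinimal] (C : WeierstrassCurve.VariableChange ℚ),
        C • W = cm7.quadraticTwist (d : ℚ) → W.analyticRank = 1 →
      ∀ (K : Type) [Field K] [NumberField K], IsImaginaryQuadratic K →
      ∀ (v vbar : HeightOneSpectrum (𝓞 K)),
        ((2 : ℕ) : 𝓞 K) ∈ v.asIdeal → ((2 : ℕ) : 𝓞 K) ∈ vbar.asIdeal → vbar ≠ v →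
      ∀ (π : (W.baseChange K).endRing), (π : AddMonoid.End (W.baseChange K).geomPoints) * π = π - 2 →
      ∀ (r : ℤ_[2]), r * r = r - 2 →
        (∀ τ ∈ GreenbergSelmer.inertia v, ∀ x : ↥((W.baseChange K).endEigenPrimaryTorsion 2 π r), τ • x = x ∨ τ • x = -x) →
      ∀ (P : W.toAffine.Point) (c₀ : ℕ) (ℓ : ℤ),
        ¬ IsOfFinAddOrder P →
        (∀ R : W.toAffine.Point, ∃ (k : ℤ) (T : W.toAffine.Point), IsOfFinAddOrder T ∧ R = k • P + T) →
        c₀ ≠ 0 → (W.baseChange ℚ_[2]).IsInReductionKernel (c₀ • W.toPadicPoint 2 P) →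
        ‖(W.baseChange ℚ_[2]).padicLogPoint (c₀ • W.toPadicPoint 2 P) / (c₀ : ℚ_[2])‖ = (2 : ℝ) ^ (-ℓ) →
      Finite (restrictedSelmerBase ↥((W.baseChange K).endEigenPrimaryTorsion 2 π r) 2 vbar) →
        (padicValNat 2 (Nat.card ((resOfLe ↥((W.baseChange K).endEigenPrimaryTorsion 2 π r) (inf_le_left : ⊤ ⊓ decomp v ≤ ⊤)).comp
          (restrictedSelmerBase ↥((W.baseChange K).endEigenPrimaryTorsion 2 π r) 2 vbar).subtype).range) : ℤ) = ℓ + e₃ (d % 2) ((d / (2 - d % 2)) % 8))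
    (hH2 : ∀ (d : ℤ), d ≠ 0 → Squarefree d → d % 4 ≠ 1 →
      ∀ (W : WeierstrassCurve ℚ) [W.IsElliptic] [W.IsGloballyMinimal] (C : WeierstrassCurve.VariableChange ℚ),
        C • W = cm7.quadraticTwist (d : ℚ) → W.analyticRank = 1 →
      ∀ (K : Type) [Field K] [NumberField K], IsImaginaryQuadratic K →
      ∀ (v vbar : HeightOneSpectrum (𝓞 K)),
        ((2 : ℕ) : 𝓞 K) ∈ v.asIdeal → ((2 : ℕ) : 𝓞 K) ∈ vbar.asIdeal → vbar ≠ v →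
      ∀ (π : (W.baseChange K).endRing), (π : AddMonoid.End (W.baseChange K).geomPoints) * π = π - 2 →
      ∀ (r : ℤ_[2]), r * r = r - 2 →
        (∀ τ ∈ GreenbergSelmer.inertia v, ∀ x : ↥((W.baseChange K).endEigenPrimaryTorsion 2 π r), τ • x = x ∨ τ • x = -x) →
      ∀ (P : W.toAffine.Point) (c₀ : ℕ) (ℓ : ℤ),
        ¬ IsOfFinAddOrder P →
        (∀ R : W.toAffine.Point, ∃ (k : ℤ) (T : W.toAffine.Point), IsOfFinAddOrder T ∧ R = k • P + T) →
        c₀ ≠ 0 → (W.baseChange ℚ_[2]).IsInReductionKernel (c₀ • W.toPadicPoint 2 P) →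
        ‖(W.baseChange ℚ_[2]).padicLogPoint (c₀ • W.toPadicPoint 2 P) / (c₀ : ℚ_[2])‖ = (2 : ℝ) ^ (-ℓ) →
      Finite (restrictedSelmerBase ↥((W.baseChange K).endEigenPrimaryTorsion 2 π r) 2 vbar) →
        (restrictedSelmerBase ↥((W.baseChange K).endEigenPrimaryTorsion 2 π r) 2 v ⊓
            (((W.baseChange K).localKerOver 2 ⊤ (vbar.adicCompletion K)).comap
          (resH1Hom (ContinuousMonoidHom.id _) ((W.baseChange K).endEigenPrimaryTorsion 2 π r).subtype (fun _ _ ↦ rfl)))).map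
            (resOfLe ↥((W.baseChange K).endEigenPrimaryTorsion 2 π r) (inf_le_left : ⊤ ⊓ decomp vbar ≤ ⊤)) ≤
          (((((W.baseChange K).kummerMapPInfty 2 (W.baseChange K).zsmul_geomPoints_surjective_holds).range).map
            (resSubgroup ⊤ ((W.baseChange K).geomPrimaryTorsion 2))).comap
          (resH1Hom (ContinuousMonoidHom.id _) ((W.baseChange K).endEigenPrimaryTorsion 2 π r).subtype (fun _ _ ↦ rfl))).map
            (resOfLe ↥((W.baseChange K).endEigenPrimaryTorsion 2 π r) (inf_le_left : ⊤ ⊓ decomp vbar ≤ ⊤)))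
    (hcl : ∀ (d : ℤ), d ≠ 0 → Squarefree d → d % 4 ≠ 1 →
      ∀ (W : WeierstrassCurve ℚ) [W.IsElliptic] [W.IsGloballyMinimal] (C : WeierstrassCurve.VariableChange ℚ),
        C • W = cm7.quadraticTwist (d : ℚ) → W.analyticRank = 1 →
      ∀ (K : Type) [Field K] [NumberField K], IsImaginaryQuadratic K →
      ∀ (v vbar : HeightOneSpectrum (𝓞 K)),
        ((2 : ℕ) : 𝓞 K) ∈ v.asIdeal → ((2 : ℕ) : 𝓞 K) ∈ vbar.asIdeal → vbar ≠ v →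
      ∀ (π : (W.baseChange K).endRing), (π : AddMonoid.End (W.baseChange K).geomPoints) * π = π - 2 →
      ∀ (r : ℤ_[2]), r * r = r - 2 →
        (∀ τ ∈ GreenbergSelmer.inertia v, ∀ x : ↥((W.baseChange K).endEigenPrimaryTorsion 2 π r), τ • x = x ∨ τ • x = -x) →
      ∀ (P : W.toAffine.Point) (c₀ : ℕ) (ℓ : ℤ),
        ¬ IsOfFinAddOrder P →
        (∀ R : W.toAffine.Point, ∃ (k : ℤ) (T : W.toAffine.Point), IsOfFinAddOrder T ∧ R = k • P + T) →
        c₀ ≠ 0 → (W.baseChange ℚ_[2]).IsInReductionKernel (c₀ • W.toPadicPoint 2 P) →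
        ‖(W.baseChange ℚ_[2]).padicLogPoint (c₀ • W.toPadicPoint 2 P) / (c₀ : ℚ_[2])‖ = (2 : ℝ) ^ (-ℓ) →
      Finite (restrictedSelmerBase ↥((W.baseChange K).endEigenPrimaryTorsion 2 π r) 2 vbar) →
        ∀ x ∈ (((W.baseChange K).localKerOver 2 ⊤ (v.adicCompletion K)).map
          (resOfLe ((W.baseChange K).geomPrimaryTorsion 2) (inf_le_left : ⊤ ⊓ decomp v ≤ ⊤))),
        ∀ y ∈ (((W.baseChange K).localKerOver 2 ⊤ (v.adicCompletion K)).map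
          (resOfLe ((W.baseChange K).geomPrimaryTorsion 2) (inf_le_left : ⊤ ⊓ decomp v ≤ ⊤))),
          2 • x = 0 → 2 • y = 0 → x ≠ 0 → ∃ m : ℤ, y = m • x) :
    -- CONCLUSION: S3c `stub_restrictedControl_two`, v9 = v10.3 VERBATIM
    ∃ eC : ℤ → ℤ → ℤ,
    ∀ (d : ℤ), d ≠ 0 → Squarefree d → d % 4 ≠ 1 →
    ∀ (W : WeierstrassCurve ℚ) [W.IsElliptic] [W.IsGloballyMinimal] (C : VariableChange ℚ),
      C • W = cm7.quadraticTwist (d : ℚ) → W.analyticRank = 1 →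
    ∀ (K : Type) [Field K] [NumberField K], IsImaginaryQuadratic K →
    ∀ (v vbar : HeightOneSpectrum (𝓞 K)),
      ((2 : ℕ) : 𝓞 K) ∈ v.asIdeal → ((2 : ℕ) : 𝓞 K) ∈ vbar.asIdeal → vbar ≠ v →
    ∀ (π : (W.baseChange K).endRing), (π : AddMonoid.End (W.baseChange K).geomPoints) * π = π - 2 →
    ∀ (r : ℤ_[2]), r * r = r - 2 →
      (∀ τ ∈ GreenbergSelmer.inertia v, ∀ x : ↥((W.baseChange K).endEigenPrimaryTorsion 2 π r), τ • x = x ∨ τ • x = -x) →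
    ∀ (κ' : ZpExtension K 2), κ'.IsUnramifiedOutside vbar → ∀ (γ' : absoluteGaloisGroup K), κ'.IsTopGenerator γ' →
    ∀ (D : Agboola2007.RestrictedDualData κ' ↥((W.baseChange K).endEigenPrimaryTorsion 2 π r) vbar γ') (n : ℕ),
      Module.Finite (IwasawaAlgebra 2) D.X → D.HasCharValuationAt n →
    ∀ (P : W.toAffine.Point) (c₀ : ℕ) (ℓ : ℤ),
      ¬ IsOfFinAddOrder P →
      (∀ R : W.toAffine.Point, ∃ (k : ℤ) (T : W.toAffine.Point), IsOfFinAddOrder T ∧ R = k • P + T) →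
      c₀ ≠ 0 → (W.baseChange ℚ_[2]).IsInReductionKernel (c₀ • W.toPadicPoint 2 P) →
      ‖(W.baseChange ℚ_[2]).padicLogPoint (c₀ • W.toPadicPoint 2 P) / (c₀ : ℚ_[2])‖ = (2 : ℝ) ^ (-ℓ) →
      (n : ℤ) = ((padicValNat 2 (Nat.card (AddCommGroup.primaryComponent W.sha 2)) : ℤ)
            + (padicValNat 2 W.tamagawaProduct : ℤ)
            - 2 * (padicValNat 2 W.torsionOrder : ℤ) + 2 * ℓ) + eC (d % 2) ((d / (2 - d % 2)) % 8) := by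
  haveI : Fact (Nat.Prime 2) := ⟨Nat.prime_two⟩
  exact restrictedControl_two_of_locSurj_bv' hPT hcd (ConjTransport.locSurjFin_of_poitouTate hPTs)
    (CMPrimes.rBV_of_factor_values_of_locCyclic hF1 hF3 hH2 hcl)

end Summit.BirchSwinnertonDyer.BirchSwinnertonDyer.Theorems.PrintCf2.RestrictedSelmerPair

end
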